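import Summits.Parity.GeneralizedHardyLittlewood.Theorems.BeyondDiagonalBeatsQuarter.OffDiagCoreWinMembers
import Summits.Parity.GeneralizedHardyLittlewood.Theorems.BeyondDiagonalBeatsQuarter.OffDiagCoreWinFactor
import Summits.Parity.GeneralizedHardyLittlewood.Theorems.BeyondDiagonalBeatsQuarter.OffDiagLevelFactorUnitBox
import HarnessLib

/-!
# Route `PrimeLevelFamEdge`, crux K_B (stmt-Parity-20343), line `diagonal_kernel_split` rev 4, plan Ω,
# node **L7d part 2, leaf G4a — τ-free majorants of the member weights of the block family, and their vanishing off the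
# unit box** (L7D-PLAN rev 7 §7 G4; the inputs of F1c `norm_integral_integral_le_of_box` after G3 `norm_blockFamily_le`)

In G3 the member weight at the box point `τ` is `A_x(τ) = c_{x,b,k,w}·Kern_x(τ)` with
`Kern_x(τ) = θ(τ₁)θ(τ₂)·(d₁K₁τ₁·d₂K₂τ₂)^{−1/2}(r+1)⁻¹·e(−K₂τ₂·s/h₁)` and
`c_{x,b,k,w} = 𝟙[cop]·E_x·convexCoeff(…)(P)(k)·t_{w₁}(l)t_{w₂}(m)·K₁K₂`. This file records:

* `unitBoxKernel_eq_zero_off_box` — `Kern_x(τ) = 0` unless `τ ∈ (1/2,2)²` (`WhitneyConvex.dyadicBump` support);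
* **`norm_unitBoxKernel_le`** — on the open box `‖Kern_x(τ)‖ ≤ 2·(d₁d₂K₁K₂)^{−1/2}·(r+1)⁻¹` (`θ ≤ 1`, `|e(·)| = 1`, `τ_j > 1/2`);
* **`norm_memberScalar_le`** — `‖c_{x,b,k,w}‖ ≤ 2·sepWeight P k·|t_{w₁}(l)t_{w₂}(m)|·K₁K₂` for `k < P` and `‖D‖ ≤ 1`
  (`norm_convexCoeff_le`);
* `sum_sq_le_sup_mul_sum` — the aggregate step `Σ v² ≤ (max v)·Σ v` for nonnegative fibres.

Elementary; standard axioms. Helper toward `stub_offDiagBelowSlack_io`; closes nothing.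
«The programme SEARCHES and TYPES; no claim about Landau–Siegel zeros, Theorems 1–2 of arXiv:2211.02515 or
a repaired Margin232 until a kernel theorem says so.»
-/

noncomputable section

open Finset Real Complex

namespace Summit.Parity.GeneralizedHardyLittlewood.Theorems.BeyondDiagonalBeatsQuarter.OffDiag

open Literature.Analysis.Calculus.WhitneyConvex (dyadicBump dyadicBump_nonneg dyadicBump_le_one mem_Ioo_of_dyadicBump_ne_zero)
open Literature.NumberTheory.Sieve.FriedlanderIwaniecPrimes (ker norm_ker)
open Literature.NumberTheory.Sieve.LargeSieve (sepWeight sepWeight_nonneg)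

/-! ### §1. The unit-box kernel of a member -/

/-- **The unit-box kernel vanishes off the open box `(1/2,2)²`.** [folklore] -/
theorem unitBoxKernel_eq_zero_off_box (d₁ d₂ r : ℕ) (i : ℕ × ℕ) (σ : ℝ) {τ₁ τ₂ : ℝ}
    (h : ¬ (τ₁ ∈ Set.Ioo (1 / 2 : ℝ) 2 ∧ τ₂ ∈ Set.Ioo (1 / 2 : ℝ) 2)) :
    ((dyadicBump τ₁ * dyadicBump τ₂ *
        (((d₁ : ℝ) * (2 ^ i.1 * τ₁) * ((d₂ : ℝ) * (2 ^ i.2 * τ₂))) ^ (-(1 / 2 : ℝ)) * (((r + 1 : ℕ) : ℝ))⁻¹) : ℝ) : ℂ) *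
      ker (2 ^ i.2 * τ₂) σ = 0 := by
  have hθ : dyadicBump τ₁ * dyadicBump τ₂ = 0 := by
    by_contra hne
    obtain ⟨h1, h2⟩ := mul_ne_zero_iff.mp hne
    exact h ⟨mem_Ioo_of_dyadicBump_ne_zero h1, mem_Ioo_of_dyadicBump_ne_zero h2⟩
  rw [hθ, zero_mul, Complex.ofReal_zero, zero_mul]

/-- **The unit-box kernel is bounded on the open box**: for `τ₁, τ₂ > 1/2`, `d₁, d₂ ≥ 1`,
`‖Kern_x(τ)‖ ≤ ((d₁K₁/2)(d₂K₂/2))^{−1/2}·(r+1)⁻¹`. [folklore] -/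
theorem norm_unitBoxKernel_le {d₁ d₂ : ℕ} (hd₁ : 1 ≤ d₁) (hd₂ : 1 ≤ d₂) (r : ℕ) (i : ℕ × ℕ) (σ : ℝ) {τ₁ τ₂ : ℝ}
    (hτ₁ : 1 / 2 < τ₁) (hτ₂ : 1 / 2 < τ₂) :
    ‖((dyadicBump τ₁ * dyadicBump τ₂ *
        (((d₁ : ℝ) * (2 ^ i.1 * τ₁) * ((d₂ : ℝ) * (2 ^ i.2 * τ₂))) ^ (-(1 / 2 : ℝ)) * (((r + 1 : ℕ) : ℝ))⁻¹) : ℝ) : ℂ) *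
      ker (2 ^ i.2 * τ₂) σ‖ ≤
      (((d₁ : ℝ) * (2 ^ i.1 * (1 / 2)) * ((d₂ : ℝ) * (2 ^ i.2 * (1 / 2)))) ^ (-(1 / 2 : ℝ)) * (((r + 1 : ℕ) : ℝ))⁻¹) := by
  have hd₁' : (1 : ℝ) ≤ d₁ := by exact_mod_cast hd₁
  have hd₂' : (1 : ℝ) ≤ d₂ := by exact_mod_cast hd₂
  have hθ0 : 0 ≤ dyadicBump τ₁ * dyadicBump τ₂ := mul_nonneg (dyadicBump_nonneg _) (dyadicBump_nonneg _)
  have hθ1 : dyadicBump τ₁ * dyadicBump τ₂ ≤ 1 := mul_le_one₀ (dyadicBump_le_one _) (dyadicBump_nonneg _) (dyadicBump_le_one _)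
  have hA0 : 0 < (d₁ : ℝ) * (2 ^ i.1 * (1 / 2)) * ((d₂ : ℝ) * (2 ^ i.2 * (1 / 2))) := by positivity
  have hAle : (d₁ : ℝ) * (2 ^ i.1 * (1 / 2)) * ((d₂ : ℝ) * (2 ^ i.2 * (1 / 2))) ≤
      (d₁ : ℝ) * (2 ^ i.1 * τ₁) * ((d₂ : ℝ) * (2 ^ i.2 * τ₂)) := by gcongr
  have hpow : ((d₁ : ℝ) * (2 ^ i.1 * τ₁) * ((d₂ : ℝ) * (2 ^ i.2 * τ₂))) ^ (-(1 / 2 : ℝ)) ≤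
      ((d₁ : ℝ) * (2 ^ i.1 * (1 / 2)) * ((d₂ : ℝ) * (2 ^ i.2 * (1 / 2)))) ^ (-(1 / 2 : ℝ)) :=
    Real.rpow_le_rpow_of_nonpos hA0 hAle (by norm_num)
  have hpos : 0 ≤ ((d₁ : ℝ) * (2 ^ i.1 * τ₁) * ((d₂ : ℝ) * (2 ^ i.2 * τ₂))) ^ (-(1 / 2 : ℝ)) :=
    Real.rpow_nonneg (le_trans hA0.le hAle) _
  rw [norm_mul, norm_ker, mul_one, Complex.norm_real, Real.norm_eq_abs, abs_of_nonneg (by positivity)]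
  calc dyadicBump τ₁ * dyadicBump τ₂ *
        (((d₁ : ℝ) * (2 ^ i.1 * τ₁) * ((d₂ : ℝ) * (2 ^ i.2 * τ₂))) ^ (-(1 / 2 : ℝ)) * (((r + 1 : ℕ) : ℝ))⁻¹)
      ≤ 1 * (((d₁ : ℝ) * (2 ^ i.1 * (1 / 2)) * ((d₂ : ℝ) * (2 ^ i.2 * (1 / 2)))) ^ (-(1 / 2 : ℝ)) *
          (((r + 1 : ℕ) : ℝ))⁻¹) := by gcongr
    _ = _ := one_mul _

/-! ### §2. The level-free member scalar -/

open Classical in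
/-- **The member scalar is bounded**: for `k < P` and a selector with `‖D‖ ≤ 1`,
`‖𝟙[cop]·(𝟙[unit]·𝟙[adm]·D)·convexCoeff p P k·t_{w₁}(l)t_{w₂}(m)·K₁K₂‖ ≤ 2·sepWeight P k·|t_{w₁}(l)t_{w₂}(m)|·K₁K₂`.
[cite: Vaughan1980, Lemma 2 — derivation] -/
theorem norm_memberScalar_le (cop U adm : Prop) {D : ℂ} (hD : ‖D‖ ≤ 1) (p : ℕ → Prop) {P k : ℕ} (hk : k < P)
    (l m : ℕ) (w i : ℕ × ℕ) :
    ‖(if cop then (1 : ℂ) else 0) * (((if U then (1 : ℂ) else 0) * (if adm then (1 : ℂ) else 0) * D) *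
        convexCoeff p P k * ((trinomCoeff l w.1 * trinomCoeff m w.2 : ℝ) : ℂ) * (((2 : ℝ) ^ i.1 * 2 ^ i.2 : ℝ) : ℂ))‖ ≤
      2 * sepWeight P k * |trinomCoeff l w.1 * trinomCoeff m w.2| * (2 ^ i.1 * 2 ^ i.2) := by
  have h1 : ‖(if cop then (1 : ℂ) else 0)‖ ≤ 1 := by split_ifs <;> simp
  have h2 : ‖(if U then (1 : ℂ) else 0)‖ ≤ 1 := by split_ifs <;> simp
  have h3 : ‖(if adm then (1 : ℂ) else 0)‖ ≤ 1 := by split_ifs <;> simp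
  have hE : ‖(if U then (1 : ℂ) else 0) * (if adm then (1 : ℂ) else 0) * D‖ ≤ 1 := by
    rw [norm_mul, norm_mul]
    exact mul_le_one₀ (mul_le_one₀ h2 (norm_nonneg _) h3) (norm_nonneg _) hD
  have hC := norm_convexCoeff_le p hk
  have hW0 := sepWeight_nonneg P k
  have hK : ‖(((2 : ℝ) ^ i.1 * 2 ^ i.2 : ℝ) : ℂ)‖ = 2 ^ i.1 * 2 ^ i.2 := by
    rw [Complex.norm_real, Real.norm_eq_abs, abs_of_nonneg (by positivity)]
  have hT : ‖((trinomCoeff l w.1 * trinomCoeff m w.2 : ℝ) : ℂ)‖ = |trinomCoeff l w.1 * trinomCoeff m w.2| := by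
    rw [Complex.norm_real, Real.norm_eq_abs]
  -- peel the product from the right
  have h12 : ‖((if U then (1 : ℂ) else 0) * (if adm then (1 : ℂ) else 0) * D) * convexCoeff p P k‖ ≤
      2 * sepWeight P k := by
    rw [norm_mul]
    calc _ ≤ 1 * (2 * sepWeight P k) := mul_le_mul hE hC (norm_nonneg _) zero_le_one
      _ = _ := one_mul _
  have h123 : ‖((if U then (1 : ℂ) else 0) * (if adm then (1 : ℂ) else 0) * D) * convexCoeff p P k *
      ((trinomCoeff l w.1 * trinomCoeff m w.2 : ℝ) : ℂ)‖ ≤ 2 * sepWeight P k * |trinomCoeff l w.1 * trinomCoeff m w.2| := by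
    rw [norm_mul, hT]
    exact mul_le_mul_of_nonneg_right h12 (abs_nonneg _)
  have h1234 : ‖((if U then (1 : ℂ) else 0) * (if adm then (1 : ℂ) else 0) * D) * convexCoeff p P k *
      ((trinomCoeff l w.1 * trinomCoeff m w.2 : ℝ) : ℂ) * (((2 : ℝ) ^ i.1 * 2 ^ i.2 : ℝ) : ℂ)‖ ≤
      2 * sepWeight P k * |trinomCoeff l w.1 * trinomCoeff m w.2| * (2 ^ i.1 * 2 ^ i.2) := by
    rw [norm_mul, hK]
    exact mul_le_mul_of_nonneg_right h123 (by positivity)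
  rw [norm_mul]
  calc _ ≤ 1 * (2 * sepWeight P k * |trinomCoeff l w.1 * trinomCoeff m w.2| * (2 ^ i.1 * 2 ^ i.2)) :=
        mul_le_mul h1 h1234 (norm_nonneg _) zero_le_one
    _ = _ := one_mul _

/-! ### §3. The aggregate step -/

/-- **Aggregate ℓ² against sup × ℓ¹**: for nonnegative fibre values, `Σ_k v_k² ≤ (max_k v_k)·Σ_k v_k` in the form with an
explicit bound `v_k ≤ V`. [folklore] -/
theorem sum_sq_le_sup_mul_sum {κ : Type*} (s : Finset κ) (v : κ → ℝ) {V : ℝ} (hv0 : ∀ k ∈ s, 0 ≤ v k)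
    (hvV : ∀ k ∈ s, v k ≤ V) : ∑ k ∈ s, v k ^ 2 ≤ V * ∑ k ∈ s, v k := by
  rw [Finset.mul_sum]
  refine Finset.sum_le_sum fun k hk ↦ ?_
  rw [sq]
  exact mul_le_mul_of_nonneg_right (hvV k hk) (hv0 k hk)

end Summit.Parity.GeneralizedHardyLittlewood.Theorems.BeyondDiagonalBeatsQuarter.OffDiag
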